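import Summits.BirchSwinnertonDyer.BirchSwinnertonDyer.Theses.PrintX10b
import Summits.BirchSwinnertonDyer.BirchSwinnertonDyer.Theorems.PrintX10bHeegnerRoadSplitTwo
import Summits.BirchSwinnertonDyer.Rank1Residual.X10.CoreTheoremAOddPrimeHolds
import Literature.NumberTheory.EllipticCurves.Greenberg1999.RankZeroEulerCharacteristicOddPrimeProofs
import Literature.NumberTheory.EllipticCurves.SkinnerUrban2014.PAdicUnitPeriodRatioProofs
import HarnessLib

/-!
# Route PrintX10b (rev 3) — the assembly item `AssemblyHeegner` (stmt-BirchSwinnertonDyer-21207), PROVED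

Cell `bsd-print-x9` (D-0131 (2) PRINT tier, key `x9`, leaves ClassX9 + ClassX10b), seat `bsd-print-x9-p1`
(prover p1, gen 3); port of the planner's sketch (`HOME/plan/x10b3/Sketch.lean`, planner g2, farm rc 0; TURNKEY 2026-08-27T18:09:19Z for rev 3b).

The rev-3 assembly of route PrintX10b,
`AssemblyHeegner := HeegnerDivisibilityX10b → AnalyticMuZeroX10b → HeegnerPrintFactsX10b → PrintFactsX10b →
X10.BSDpOnClassX10b`, is p4's landed kernel ROAD B AT `p = 3`
`Rank1Residual.X10.bsdpOnClassX10b_of_mazurMainConjectureOnClassX10b_of_heegnerDivisibility` (p547087,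
`Theorems/PrintX10bHeegnerRoad.lean` §3), in its rev-3b TWIN `…_of_heegnerDivisibilitySplitTwo`
(`Theorems/PrintX10bHeegnerRoadSplitTwo.lean`: the crux J₃ BY NAME with the extra frame binder
`NumberField.discr K % 8 = 1`, one token `hd8K` re-threaded), read on the route's items: destructure the Heegner/CM print bundle
`HeegnerPrintFactsX10b` (15 conjuncts, kernel order) and the cyclotomic print bundle `PrintFactsX10b`
(7 conjuncts), feed the integral Mazur main conjecture on the class from the Kato/Greenberg–Vatsal engine
`X10.mazurMainConjectureOnClassX10b_of_fine` (Kato's fine-quotient package F1 + Yan–Zhu Thm 4.9 + Mazur's odd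
Manin constant periods + `AnalyticMuZeroX10b`), and Greenberg's rank-`0` characteristic value from
Schneider 1985 + the Mazur–Tate `σ` (`greenberg_charValue_rankZero_of_Schneider1985_odd`,
`mazur_tate_sigma_exists_odd_holds`). NO Schneider conjecture, NO `p`-adic height.

HONEST STATUS: this closes the ASSEMBLY item only — the leaf `X10.BSDpOnClassX10b` stays conditional on the
two cruxes `AnalyticMuZeroX10b` (20682, Greenberg's analytic `μ = 0` at `3` on the class) and
`HeegnerDivisibilityX10b` (21340, rev 3b; J₃: Heegner divisibility to Tamagawa depth at `3` on the non-CM rank-`1`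
members over Heegner frames with `2` split; in print only at `p > 3` under surjective image) and on the two print bundles (flags E114 on Kato's
F1, `YZ26@3-BF-ERL-Ohta` on Yan–Zhu at `3`, `Cha05-Rmk25-remark-only`); BSD is not proved here.
beyond-print theorem: no (bookkeeping over landed kernel theorems).
-/

namespace Summit.BirchSwinnertonDyer.Rank1Residual.X10

open Literature.NumberTheory.EllipticCurves Literature.NumberTheory.EllipticCurves.SkinnerUrban2014
open Summit.BirchSwinnertonDyer.BirchSwinnertonDyer.Theses.PrintX10b

/-- **Assembly of route PrintX10b, rev 3 (road B at `3`)** (item stmt-BirchSwinnertonDyer-21207): Heegner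
divisibility to Tamagawa depth on the non-CM rank-`1` members of X10b (`HeegnerDivisibilityX10b`, J₃),
Greenberg's analytic `μ = 0` at `3` on the class (`AnalyticMuZeroX10b`), the Heegner/CM print bundle
`HeegnerPrintFactsX10b` and the cyclotomic print bundle `PrintFactsX10b` give `BSD_3` on the whole leaf
`X10.BSDpOnClassX10b`: rank `0` and the rank-`0` Heegner twists by the integral Mazur main conjecture on the
class (`X10.mazurMainConjectureOnClassX10b_of_fine`: Kato fine quotient + Yan–Zhu Thm 4.9 + Mazur periods +
`μ_an = 0`), rank-`1` non-CM members by Heegner divisibility + Cha Rmk 25 + STEP L at `3` + JSW descent, rank-`1`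
CM members by the CM bridge — all inside (the rev-3b twin of) p4's kernel
`X10.bsdpOnClassX10b_of_mazurMainConjectureOnClassX10b_of_heegnerDivisibilitySplitTwo`; Greenberg's rank-`0`
value from Schneider 1985 + Mazur–Tate `σ`. [cite: Cha2005, Rmk. 25 (p. 175)]
[cite: YanZhu2024MainConjNonCM, Thm. 4.9 (§4.4) and Thm. 5.7 (1)]
[cite: Kato2004Asterisque, Thm. 12.6 (p. 222) and §17.13 (pp. 279–280)]
[cite: GreenbergLNM1716, Thm. 4.1 (p. 102) and §1 Conj. 1.11] [cite: Mazur1978, Cor. 4.1]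
[cite: Schneider1985, Thm. 2'] -/
theorem printX10b_assemblyHeegner_proof :
    Summit.BirchSwinnertonDyer.BirchSwinnertonDyer.Theses.PrintX10b.AssemblyHeegner := by
  intro hJ hA hHP hP
  obtain ⟨hGZ, hKo, hrec, hD36, hChaU, h526, h57, h331, hmod, hnf, hHL, hNS, hCM, hLLT, hKob⟩ := hHP
  obtain ⟨hYZ, hM, hS, hPR, hmodP, hGZK, hfine⟩ := hP
  exact Summit.BirchSwinnertonDyer.BirchSwinnertonDyer.Rank1Residual.X10.bsdpOnClassX10b_of_mazurMainConjectureOnClassX10b_of_heegnerDivisibilitySplitTwo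
    hGZ hKo hrec hD36 hChaU h526 h57 h331
    (greenberg_charValue_rankZero_of_Schneider1985_odd hS mazur_tate_sigma_exists_odd_holds)
    hGZK hmod hmodP hnf hHL hM hNS hCM hLLT hKob
    (mazurMainConjectureOnClassX10b_of_fine hYZ (realPeriodRat_eq_unit_mul_plusPeriod_of_mazur hM)
      (realPeriodRat_eq_unit_mul_plusPeriod_three_of_mazur hM) hmodP hfine hA)
    hJ

end Summit.BirchSwinnertonDyer.Rank1Residual.X10
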